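import Summits.AtomisticToContinuum.Crystallization.Theorems.FrustratedLawDichotomyAperiodicGapCountableCut

/-!
# FrustratedLawDichotomy · crux `AperiodicFrustratedLawGap` (stmt-AtomisticToContinuum-27623) — COUNTEREXAMPLES HAVE A RELATIVELY ∀ δ : ℝ, 0 < δ → ∀ P : MeasureTheory.Measure (MeasureTheory.Measure (EuclideanSpace ℝ (Fin 3))), let Gy : ℝ → (N : ℕ) → (Fin N → EuclideanSpace ℝ (Fin 3)) → Fin N → Prop := fun η N y j => let d : ℝ := sInf ((fun z => dist z (y (j : Fin N))) '' (Set.range (y) \ {(y (j : Fin N))})); let T : Set (EuclideanSpace ℝ (Fin 3)) := {z : EuclideanSpace ℝ (Fin 3) | z ∈ Set.range (y) ∧ z ≠ (y (j : Fin N)) ∧ dist z (y (j : Fin N)) < 13 / 10 * d}; ∃ A : EuclideanSpace ℝ (Fin 3) →ₗᵢ[ℝ] EuclideanSpace ℝ (Fin 3), (∃ e : ↥T ≃ ↥Literature.Geometry.DiscreteGeometry.fccKissingPattern, ∀ t : ↥T, dist (d⁻¹ • ((t : EuclideanSpace ℝ (Fin 3)) - (y (j : Fin N)))) (A ((e t :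 ↥Literature.Geometry.DiscreteGeometry.fccKissingPattern) : EuclideanSpace ℝ (Fin 3))) ≤ η) ∨ (∃ e : ↥T ≃ ↥Literature.Geometry.DiscreteGeometry.hcpKissingPattern, ∀ t : ↥T, dist (d⁻¹ • ((t : EuclideanSpace ℝ (Fin 3)) - (y (j : Fin N)))) (A ((e t : ↥Literature.Geometry.DiscreteGeometry.hcpKissingPattern) : EuclideanSpace ℝ (Fin 3))) ≤ η); let TexBall : (N : ℕ) → (Fin N → EuclideanSpace ℝ (Fin 3)) → Fin N → ℝ → ℝ → ℝ → ℝ → Prop := fun N y i R R₇ R₈ R₉ => (∀ a b : Fin N, a ≠ b → (7 : ℝ) / 10 ≤ dist (y a) (y b)) ∧ (∀ j : Fin N, dist (y j) (y i) ≤ R → ¬ Gy (1 / 20) N (y) j) ∧ (∀ j : Fin N, dist (y j) (y i) ≤ R → ¬ ((∀ j' : Fin N, dist (y j') (y j) ≤ R₇ → ¬ Gy (1 / 20) N (y) j') ∧ (∀ z : EuclideanSpace ℝ (Fin 3), dist z (y j) ≤ R₇ → ∃ k : Fin N, dist z (y k) ≤ 1) ∧ (∀ j' : Fin N, dist (y j')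 (y j) ≤ R₇ → (let d : ℝ := sInf ((fun z => dist z (y j')) '' (Set.range (y) \ {(y j')})); ∀ k : Fin N, y k ≠ y j' → dist (y k) (y j') < 27 / 20 * d → 5 ≤ Nat.card {m : Fin N // y m ≠ y j' ∧ dist (y m) (y j') < 27 / 20 * d ∧ y m ≠ y k ∧ dist (y m) (y k) < 27 / 20 * d})))) ∧ (∀ j : Fin N, dist (y j) (y i) ≤ R → ∃ k : Fin N, dist (y k) (y j) ≤ R₈ ∧ Gy (1 / 8) N (y) k) ∧ (∀ j : Fin N, dist (y j) (y i) ≤ R → ¬ ((∀ j' : Fin N, dist (y j') (y j) ≤ R₉ → ¬ Gy (1 / 20) N (y) j') ∧ (Nat.card {j' : Fin N // dist (y j') (y j) ≤ R₉ ∧ ¬ Gy (1 / 8) N (y) j'} : ℝ) ≤ 1 / 2 * (Nat.card {j' : Fin N // dist (y j') (y j) ≤ R₉} : ℝ) ∧ (∀ j' : Fin N, dist (y j') (y j) ≤ R₉ → ¬ Gy (1 / 8) N (y) j' → ¬ (let d : ℝ := sInf ((fun z => dist z (y j')) '' (Set.range (y) \ {(y j')})); ∀ k : Fin N, y k ≠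 y j' → dist (y k) (y j') < 27 / 20 * d → 5 ≤ Nat.card {m : Fin N // y m ≠ y j' ∧ dist (y m) (y j') < 27 / 20 * d ∧ y m ≠ y k ∧ dist (y m) (y k) < 27 / 20 * d})))); let Appr : MeasureTheory.Measure (EuclideanSpace ℝ (Fin 3)) → ℝ → ℝ → ℝ → Prop := fun μ R₇ R₈ R₉ => ∀ q : EuclideanSpace ℝ (Fin 3), μ {q} ≠ 0 → ∀ R ε : ℝ, 0 < ε → ∃ (N : ℕ) (y : Fin N → EuclideanSpace ℝ (Fin 3)) (i : Fin N), TexBall N y i R R₇ R₈ R₉ ∧ (∀ p : EuclideanSpace ℝ (Fin 3), μ {p} ≠ 0 → dist p q ≤ R → ∃ k : Fin N, dist (y k - y i) (p - q) ≤ ε) ∧ (∀ k : Fin N, dist (y k) (y i) ≤ R → ∃ p : EuclideanSpace ℝ (Fin 3), μ {p} ≠ 0 ∧ dist (y k - y i) (p - q) ≤ ε); MeasureTheory.IsProbabilityMeasure P → (∀ᵐ μ ∂P, Literature.Probability.Process.IsRootedHardCore δ μ) → Literature.Probability.Process.IsPointStationaryLaw P → (∃ R₇ R₈ R₉ : ℝ,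 ∀ᵐ μ ∂P, Appr μ R₇ R₈ R₉) → (∀ᵐ μ ∂P, ∀ p : EuclideanSpace ℝ (Fin 3), μ {p} ≠ 0 → ∀ y : EuclideanSpace ℝ (Fin 3), (∀ q : EuclideanSpace ℝ (Fin 3), μ {q} ≠ 0 → q ≠ p → y ≠ q) → ∑' q : {q : EuclideanSpace ℝ (Fin 3) // μ {q} ≠ 0 ∧ q ≠ p}, Literature.MathematicalPhysics.StatisticalMechanics.lennardJones (dist p (q : EuclideanSpace ℝ (Fin 3))) ≤ ∑' q : {q : EuclideanSpace ℝ (Fin 3) // μ {q} ≠ 0 ∧ q ≠ p}, Literature.MathematicalPhysics.StatisticalMechanics.lennardJones (dist y (q : EuclideanSpace ℝ (Fin 3)))) → P {μ : MeasureTheory.Measure (EuclideanSpace ℝ (Fin 3)) | ∃ Q : Literature.MathematicalPhysics.StatisticalMechanics.PeriodicConfiguration 3, ∃ t : EuclideanSpace ℝ (Fin 3), {p : EuclideanSpace ℝ (Fin 3) | μ {p} ≠ 0} = (fun s => s + t) '' Q.points} = 0 → (∀ᵐ μ ∂P, ∀ v : EuclideanSpace ℝ (Fin 3), ∃ s s'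 : EuclideanSpace ℝ (Fin 3), μ {s} ≠ 0 ∧ μ {s'} ≠ 0 ∧ ‖s - s' + v‖ ≤ 2) → (⨅ Q : Literature.MathematicalPhysics.StatisticalMechanics.PeriodicConfiguration 3, Q.energyPerParticle Literature.MathematicalPhysics.StatisticalMechanics.lennardJones) < (∫ μ, Literature.MathematicalPhysics.StatisticalMechanics.rootEnergy Literature.MathematicalPhysics.StatisticalMechanics.lennardJones μ ∂P)
# DIFFERENCE SET (decomp-a2c, prover hand 2, structural share)

Instance of the countable cut (`aperiodicFrustratedLawGap_cut_iUnion`) with the no-pair events of ALL points of the dense sequence as offsets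
(`FrustratedLawDichotomyAperiodicGapNoPairCut`, `FrustratedLawDichotomyDoublingGap`): granted the floor of item 9229,

* `aperiodicFrustratedLawGap_iff_offAllNoPair` — the crux (by name) ⟺ its restriction to laws almost surely outside EVERY no-pair event;
* `aperiodicFrustratedLawGap_iff_denseDifferences` — equivalently (closedness in the offset), ⟺ its restriction to laws almost surely carried
  by configurations whose DIFFERENCE SET is 2-relatively dense: for every `v ∈ ℝ³` there are atoms `s, s'` with `‖s − s' + v‖ ≤ 2`.

So a counterexample to `AperiodicFrustratedLawGap` — an aperiodic texture-charging Nash hard-core point-stationary exact minimiser — is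
automatically almost surely infinite, slab-free and rod-free in every direction, with no forbidden offset at all.  All `[folklore]`.
-/

noncomputable section

namespace Summit.AtomisticToContinuum.Crystallization.Theorems.FrustratedLawDichotomyAperiodicGapFiniteCut

open MeasureTheory Metric Set Filter ProbabilityTheory TopologicalSpace
open scoped ENNReal Topology BigOperators
open Literature.MathematicalPhysics.StatisticalMechanics Literature.Probability.Process
open Summit.AtomisticToContinuum.Crystallization.Theorems.ChargedEnergyGapNegative (E3 eStar)
open Summit.AtomisticToContinuum.Crystallization.Theorems.FrustratedLawDichotomyFiniteClusterGap
  (eStar_lt_integral_rootEnergy_of_ae_noPair)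

section DenseDifferences

/-- **All no-pair classes peeled off at once**: granted the floor, the crux is equivalent to its restriction to laws almost surely outside the
no-pair event of EVERY offset of the dense sequence. [folklore] -/
theorem aperiodicFrustratedLawGap_iff_offAllNoPair
    (hU : ∀ δ' : ℝ, 0 < δ' → ∀ Q : MeasureTheory.Measure (MeasureTheory.Measure (EuclideanSpace ℝ (Fin 3))), MeasureTheory.IsProbabilityMeasure Q →
      (∀ᵐ μ ∂Q, Literature.Probability.Process.IsRootedHardCore δ' μ) → Literature.Probability.Process.IsPointStationaryLaw Q →
      (⨅ Q : Literature.MathematicalPhysics.StatisticalMechanics.PeriodicConfiguration 3, Q.energyPerParticle Literature.MathematicalPhysics.StatisticalMechanics.lennardJones) ≤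
        ∫ μ, Literature.MathematicalPhysics.StatisticalMechanics.rootEnergy Literature.MathematicalPhysics.StatisticalMechanics.lennardJones μ ∂Q) :
    Summit.AtomisticToContinuum.Crystallization.Theses.FrustratedLawDichotomy.AperiodicFrustratedLawGap ↔
    (∀ δ : ℝ, 0 < δ → ∀ P : MeasureTheory.Measure (MeasureTheory.Measure (EuclideanSpace ℝ (Fin 3))), let Gy : ℝ → (N : ℕ) → (Fin N → EuclideanSpace ℝ (Fin 3)) → Fin N → Prop := fun η N y j => let d : ℝ := sInf ((fun z => dist z (y (j : Fin N))) '' (Set.range (y) \ {(y (j : Fin N))})); let T : Set (EuclideanSpace ℝ (Fin 3)) := {z : EuclideanSpace ℝ (Fin 3) | z ∈ Set.range (y) ∧ z ≠ (y (j : Fin N)) ∧ dist z (y (j : Fin N)) < 13 / 10 * d}; ∃ A : EuclideanSpace ℝ (Fin 3) →ₗᵢ[ℝ] EuclideanSpace ℝ (Fin 3), (∃ e : ↥T ≃ ↥Literature.Geometry.DiscreteGeometry.fccKissingPattern, ∀ t : ↥T, dist (d⁻¹ • ((t : EuclideanSpace ℝ (Fin 3)) - (y (j : Fin N)))) (A ((e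 t : ↥Literature.Geometry.DiscreteGeometry.fccKissingPattern) : EuclideanSpace ℝ (Fin 3))) ≤ η) ∨ (∃ e : ↥T ≃ ↥Literature.Geometry.DiscreteGeometry.hcpKissingPattern, ∀ t : ↥T, dist (d⁻¹ • ((t : EuclideanSpace ℝ (Fin 3)) - (y (j : Fin N)))) (A ((e t : ↥Literature.Geometry.DiscreteGeometry.hcpKissingPattern) : EuclideanSpace ℝ (Fin 3))) ≤ η); let TexBall : (N : ℕ) → (Fin N → EuclideanSpace ℝ (Fin 3)) → Fin N → ℝ → ℝ → ℝ → ℝ → Prop := fun N y i R R₇ R₈ R₉ => (∀ a b : Fin N, a ≠ b → (7 : ℝ) / 10 ≤ dist (y a) (y b)) ∧ (∀ j : Fin N, dist (y j) (y i) ≤ R → ¬ Gy (1 / 20) N (y) j) ∧ (∀ j : Fin N, dist (y j) (y i) ≤ R → ¬ ((∀ j' : Fin N, dist (y j') (y j) ≤ R₇ → ¬ Gy (1 / 20) N (y) j') ∧ (∀ z : EuclideanSpace ℝ (Fin 3), dist z (y j) ≤ R₇ → ∃ k : Fin N, dist z (y k) ≤ 1) ∧ (∀ j' : Fin N, dist (y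 j') (y j) ≤ R₇ → (let d : ℝ := sInf ((fun z => dist z (y j')) '' (Set.range (y) \ {(y j')})); ∀ k : Fin N, y k ≠ y j' → dist (y k) (y j') < 27 / 20 * d → 5 ≤ Nat.card {m : Fin N // y m ≠ y j' ∧ dist (y m) (y j') < 27 / 20 * d ∧ y m ≠ y k ∧ dist (y m) (y k) < 27 / 20 * d})))) ∧ (∀ j : Fin N, dist (y j) (y i) ≤ R → ∃ k : Fin N, dist (y k) (y j) ≤ R₈ ∧ Gy (1 / 8) N (y) k) ∧ (∀ j : Fin N, dist (y j) (y i) ≤ R → ¬ ((∀ j' : Fin N, dist (y j') (y j) ≤ R₉ → ¬ Gy (1 / 20) N (y) j') ∧ (Nat.card {j' : Fin N // dist (y j') (y j) ≤ R₉ ∧ ¬ Gy (1 / 8) N (y) j'} : ℝ) ≤ 1 / 2 * (Nat.card {j' : Fin N // dist (y j') (y j) ≤ R₉} : ℝ) ∧ (∀ j' : Fin N, dist (y j') (y j) ≤ R₉ → ¬ Gy (1 / 8) N (y) j' → ¬ (let d : ℝ := sInf ((fun z => dist z (y j')) '' (Set.range (y) \ {(y j')})); ∀ k : Fin N, y k ≠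 y j' → dist (y k) (y j') < 27 / 20 * d → 5 ≤ Nat.card {m : Fin N // y m ≠ y j' ∧ dist (y m) (y j') < 27 / 20 * d ∧ y m ≠ y k ∧ dist (y m) (y k) < 27 / 20 * d})))); let Appr : MeasureTheory.Measure (EuclideanSpace ℝ (Fin 3)) → ℝ → ℝ → ℝ → Prop := fun μ R₇ R₈ R₉ => ∀ q : EuclideanSpace ℝ (Fin 3), μ {q} ≠ 0 → ∀ R ε : ℝ, 0 < ε → ∃ (N : ℕ) (y : Fin N → EuclideanSpace ℝ (Fin 3)) (i : Fin N), TexBall N y i R R₇ R₈ R₉ ∧ (∀ p : EuclideanSpace ℝ (Fin 3), μ {p} ≠ 0 → dist p q ≤ R → ∃ k : Fin N, dist (y k - y i) (p - q) ≤ ε) ∧ (∀ k : Fin N, dist (y k) (y i) ≤ R → ∃ p : EuclideanSpace ℝ (Fin 3), μ {p} ≠ 0 ∧ dist (y k - y i) (p - q) ≤ ε); MeasureTheory.IsProbabilityMeasure P → (∀ᵐ μ ∂P, Literature.Probability.Process.IsRootedHardCore δ μ) → Literature.Probability.Process.IsPointStationaryLaw P → (∃ R₇ R₈ R₉ : ℝ,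 ∀ᵐ μ ∂P, Appr μ R₇ R₈ R₉) → (∀ᵐ μ ∂P, ∀ p : EuclideanSpace ℝ (Fin 3), μ {p} ≠ 0 → ∀ y : EuclideanSpace ℝ (Fin 3), (∀ q : EuclideanSpace ℝ (Fin 3), μ {q} ≠ 0 → q ≠ p → y ≠ q) → ∑' q : {q : EuclideanSpace ℝ (Fin 3) // μ {q} ≠ 0 ∧ q ≠ p}, Literature.MathematicalPhysics.StatisticalMechanics.lennardJones (dist p (q : EuclideanSpace ℝ (Fin 3))) ≤ ∑' q : {q : EuclideanSpace ℝ (Fin 3) // μ {q} ≠ 0 ∧ q ≠ p}, Literature.MathematicalPhysics.StatisticalMechanics.lennardJones (dist y (q : EuclideanSpace ℝ (Fin 3)))) → P {μ : MeasureTheory.Measure (EuclideanSpace ℝ (Fin 3)) | ∃ Q : Literature.MathematicalPhysics.StatisticalMechanics.PeriodicConfiguration 3, ∃ t : EuclideanSpace ℝ (Fin 3), {p : EuclideanSpace ℝ (Fin 3) | μ {p} ≠ 0} = (fun s => s + t) '' Q.points} = 0 → (∀ᵐ μ ∂P, μ ∈ (⋃ i : ℕ, {ν : MeasureTheory.Measure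 (EuclideanSpace ℝ (Fin 3)) | ∀ n m : ℕ, ∀ r : ℚ, (0 : ℝ) < r → ‖TopologicalSpace.denseSeq (EuclideanSpace ℝ (Fin 3)) n - TopologicalSpace.denseSeq (EuclideanSpace ℝ (Fin 3)) m + TopologicalSpace.denseSeq (EuclideanSpace ℝ (Fin 3)) i‖ < 2 - 2 * (r : ℝ) → ν (Metric.ball (TopologicalSpace.denseSeq (EuclideanSpace ℝ (Fin 3)) n) r) = 0 ∨ ν (Metric.ball (TopologicalSpace.denseSeq (EuclideanSpace ℝ (Fin 3)) m) r) = 0})ᶜ) → (⨅ Q : Literature.MathematicalPhysics.StatisticalMechanics.PeriodicConfiguration 3, Q.energyPerParticle Literature.MathematicalPhysics.StatisticalMechanics.lennardJones) < (∫ μ, Literature.MathematicalPhysics.StatisticalMechanics.rootEnergy Literature.MathematicalPhysics.StatisticalMechanics.lennardJones μ ∂P)) := by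
  refine aperiodicFrustratedLawGap_cut_iUnion _ (fun i => measurableSet_noPairEvent (denseSeq E3 i))
    (fun i => noPairEvent_invariant (denseSeq E3 i)) fun i => ?_
  intro δ hδ P
  dsimp only
  intro _hP ha hb _ _ _ hK
  refine eStar_lt_integral_rootEnergy_of_ae_noPair hU hδ ha hb (denseSeq E3 i) ?_
  filter_upwards [ha, hK] with μ hμ hμK
  exact (mem_noPairEvent_iff hμ (denseSeq E3 i)).1 hμK

/-- **Counterexamples have a 2-relatively-dense difference set**: granted the floor, the crux (by name) is equivalent to its restriction to laws
almost surely carried by configurations whose difference set comes within `2 + ε` of every vector: for every `v ∈ ℝ³` and `ε > 0` there are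
atoms `s, s'` with `‖s − s' + v‖ < 2 + ε`. [folklore] -/
theorem aperiodicFrustratedLawGap_iff_denseDifferences
    (hU : ∀ δ' : ℝ, 0 < δ' → ∀ Q : MeasureTheory.Measure (MeasureTheory.Measure (EuclideanSpace ℝ (Fin 3))), MeasureTheory.IsProbabilityMeasure Q →
      (∀ᵐ μ ∂Q, Literature.Probability.Process.IsRootedHardCore δ' μ) → Literature.Probability.Process.IsPointStationaryLaw Q →
      (⨅ Q : Literature.MathematicalPhysics.StatisticalMechanics.PeriodicConfiguration 3, Q.energyPerParticle Literature.MathematicalPhysics.StatisticalMechanics.lennardJones) ≤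
        ∫ μ, Literature.MathematicalPhysics.StatisticalMechanics.rootEnergy Literature.MathematicalPhysics.StatisticalMechanics.lennardJones μ ∂Q) :
    Summit.AtomisticToContinuum.Crystallization.Theses.FrustratedLawDichotomy.AperiodicFrustratedLawGap ↔
    (∀ δ : ℝ, 0 < δ → ∀ P : MeasureTheory.Measure (MeasureTheory.Measure (EuclideanSpace ℝ (Fin 3))), let Gy : ℝ → (N : ℕ) → (Fin N → EuclideanSpace ℝ (Fin 3)) → Fin N → Prop := fun η N y j => let d : ℝ := sInf ((fun z => dist z (y (j : Fin N))) '' (Set.range (y) \ {(y (j : Fin N))})); let T : Set (EuclideanSpace ℝ (Fin 3)) := {z : EuclideanSpace ℝ (Fin 3) | z ∈ Set.range (y) ∧ z ≠ (y (j : Fin N)) ∧ dist z (y (j : Fin N)) < 13 / 10 * d}; ∃ A : EuclideanSpace ℝ (Fin 3) →ₗᵢ[ℝ] EuclideanSpace ℝ (Fin 3), (∃ e : ↥T ≃ ↥Literature.Geometry.DiscreteGeometry.fccKissingPattern, ∀ t : ↥T, dist (d⁻¹ • ((t : EuclideanSpace ℝ (Fin 3)) - (y (j : Fin N)))) (A ((e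 t : ↥Literature.Geometry.DiscreteGeometry.fccKissingPattern) : EuclideanSpace ℝ (Fin 3))) ≤ η) ∨ (∃ e : ↥T ≃ ↥Literature.Geometry.DiscreteGeometry.hcpKissingPattern, ∀ t : ↥T, dist (d⁻¹ • ((t : EuclideanSpace ℝ (Fin 3)) - (y (j : Fin N)))) (A ((e t : ↥Literature.Geometry.DiscreteGeometry.hcpKissingPattern) : EuclideanSpace ℝ (Fin 3))) ≤ η); let TexBall : (N : ℕ) → (Fin N → EuclideanSpace ℝ (Fin 3)) → Fin N → ℝ → ℝ → ℝ → ℝ → Prop := fun N y i R R₇ R₈ R₉ => (∀ a b : Fin N, a ≠ b → (7 : ℝ) / 10 ≤ dist (y a) (y b)) ∧ (∀ j : Fin N, dist (y j) (y i) ≤ R → ¬ Gy (1 / 20) N (y) j) ∧ (∀ j : Fin N, dist (y j) (y i) ≤ R → ¬ ((∀ j' : Fin N, dist (y j') (y j) ≤ R₇ → ¬ Gy (1 / 20) N (y) j') ∧ (∀ z : EuclideanSpace ℝ (Fin 3), dist z (y j) ≤ R₇ → ∃ k : Fin N, dist z (y k) ≤ 1) ∧ (∀ j' : Fin N, dist (y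 j') (y j) ≤ R₇ → (let d : ℝ := sInf ((fun z => dist z (y j')) '' (Set.range (y) \ {(y j')})); ∀ k : Fin N, y k ≠ y j' → dist (y k) (y j') < 27 / 20 * d → 5 ≤ Nat.card {m : Fin N // y m ≠ y j' ∧ dist (y m) (y j') < 27 / 20 * d ∧ y m ≠ y k ∧ dist (y m) (y k) < 27 / 20 * d})))) ∧ (∀ j : Fin N, dist (y j) (y i) ≤ R → ∃ k : Fin N, dist (y k) (y j) ≤ R₈ ∧ Gy (1 / 8) N (y) k) ∧ (∀ j : Fin N, dist (y j) (y i) ≤ R → ¬ ((∀ j' : Fin N, dist (y j') (y j) ≤ R₉ → ¬ Gy (1 / 20) N (y) j') ∧ (Nat.card {j' : Fin N // dist (y j') (y j) ≤ R₉ ∧ ¬ Gy (1 / 8) N (y) j'} : ℝ) ≤ 1 / 2 * (Nat.card {j' : Fin N // dist (y j') (y j) ≤ R₉} : ℝ) ∧ (∀ j' : Fin N, dist (y j') (y j) ≤ R₉ → ¬ Gy (1 / 8) N (y) j' → ¬ (let d : ℝ := sInf ((fun z => dist z (y j')) '' (Set.range (y) \ {(y j')})); ∀ k : Fin N, y k ≠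 y j' → dist (y k) (y j') < 27 / 20 * d → 5 ≤ Nat.card {m : Fin N // y m ≠ y j' ∧ dist (y m) (y j') < 27 / 20 * d ∧ y m ≠ y k ∧ dist (y m) (y k) < 27 / 20 * d})))); let Appr : MeasureTheory.Measure (EuclideanSpace ℝ (Fin 3)) → ℝ → ℝ → ℝ → Prop := fun μ R₇ R₈ R₉ => ∀ q : EuclideanSpace ℝ (Fin 3), μ {q} ≠ 0 → ∀ R ε : ℝ, 0 < ε → ∃ (N : ℕ) (y : Fin N → EuclideanSpace ℝ (Fin 3)) (i : Fin N), TexBall N y i R R₇ R₈ R₉ ∧ (∀ p : EuclideanSpace ℝ (Fin 3), μ {p} ≠ 0 → dist p q ≤ R → ∃ k : Fin N, dist (y k - y i) (p - q) ≤ ε) ∧ (∀ k : Fin N, dist (y k) (y i) ≤ R → ∃ p : EuclideanSpace ℝ (Fin 3), μ {p} ≠ 0 ∧ dist (y k - y i) (p - q) ≤ ε); MeasureTheory.IsProbabilityMeasure P → (∀ᵐ μ ∂P, Literature.Probability.Process.IsRootedHardCore δ μ) → Literature.Probability.Process.IsPointStationaryLaw P → (∃ R₇ R₈ R₉ : ℝ,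 ∀ᵐ μ ∂P, Appr μ R₇ R₈ R₉) → (∀ᵐ μ ∂P, ∀ p : EuclideanSpace ℝ (Fin 3), μ {p} ≠ 0 → ∀ y : EuclideanSpace ℝ (Fin 3), (∀ q : EuclideanSpace ℝ (Fin 3), μ {q} ≠ 0 → q ≠ p → y ≠ q) → ∑' q : {q : EuclideanSpace ℝ (Fin 3) // μ {q} ≠ 0 ∧ q ≠ p}, Literature.MathematicalPhysics.StatisticalMechanics.lennardJones (dist p (q : EuclideanSpace ℝ (Fin 3))) ≤ ∑' q : {q : EuclideanSpace ℝ (Fin 3) // μ {q} ≠ 0 ∧ q ≠ p}, Literature.MathematicalPhysics.StatisticalMechanics.lennardJones (dist y (q : EuclideanSpace ℝ (Fin 3)))) → P {μ : MeasureTheory.Measure (EuclideanSpace ℝ (Fin 3)) | ∃ Q : Literature.MathematicalPhysics.StatisticalMechanics.PeriodicConfiguration 3, ∃ t : EuclideanSpace ℝ (Fin 3), {p : EuclideanSpace ℝ (Fin 3) | μ {p} ≠ 0} = (fun s => s + t) '' Q.points} = 0 → (∀ᵐ μ ∂P, ∀ v : EuclideanSpace ℝ (Fin 3), ∀ ε :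 ℝ, 0 < ε → ∃ s s' : EuclideanSpace ℝ (Fin 3), μ {s} ≠ 0 ∧ μ {s'} ≠ 0 ∧ ‖s - s' + v‖ < 2 + ε) → (⨅ Q : Literature.MathematicalPhysics.StatisticalMechanics.PeriodicConfiguration 3, Q.energyPerParticle Literature.MathematicalPhysics.StatisticalMechanics.lennardJones) < (∫ μ, Literature.MathematicalPhysics.StatisticalMechanics.rootEnergy Literature.MathematicalPhysics.StatisticalMechanics.lennardJones μ ∂P)) := by
  constructor
  · intro h δ hδ P
    have h' := h δ hδ P
    dsimp only at h' ⊢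
    intro hP ha hb hd he h0 _
    exact h' hP ha hb hd he h0
  · intro h
    rw [aperiodicFrustratedLawGap_iff_offAllNoPair hU]
    intro δ hδ P
    have h' := h δ hδ P
    dsimp only at h' ⊢
    intro hP ha hb hd he h0 hoff
    refine h' hP ha hb hd he h0 ?_
    filter_upwards [ha, hoff] with μ hμ hμoff
    intro v ε hε
    obtain ⟨i, hi⟩ := Metric.denseRange_iff.1 (denseRange_denseSeq E3) v ε hε
    rw [Set.mem_compl_iff, Set.mem_iUnion, not_exists] at hμoff
    have hi' := hμoff i
    rw [mem_noPairEvent_iff hμ (denseSeq E3 i)] at hi'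
    push Not at hi'
    obtain ⟨s, s', hs, hs', hlt⟩ := hi'
    refine ⟨s, s', hs, hs', ?_⟩
    have e : s - s' + v = (s - s' + denseSeq E3 i) + (v - denseSeq E3 i) := by abel
    rw [e]
    have hv : ‖v - denseSeq E3 i‖ < ε := by rw [← dist_eq_norm]; exact hi
    linarith [norm_add_le (s - s' + denseSeq E3 i) (v - denseSeq E3 i)]


/-! ## Slabs are a forbidden-offset class

A configuration lying in a slab — `|⟪s − s', n⟫| ≤ D` for all atoms `s, s'`, some unit normal `n` — has the forbidden offset `v` for every
`v` within `1/2` of `(D + 3)·n` (`‖s − s' + v‖ ≥ ⟪v, n⟫ − D ≥ 2`), in particular for a point of the dense sequence; so slab laws are excluded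
from the residual by `aperiodicFrustratedLawGap_iff_offAllNoPair`: `aperiodicFrustratedLawGap_iff_offSlabs`. -/

/-- **A slab configuration has a forbidden offset in the dense sequence.** [folklore] -/
theorem exists_mem_noPairEvent_of_slab {δ : ℝ} {μ : Measure E3} (hμ : IsRootedHardCore δ μ) {n : E3} (hn : ‖n‖ = 1) {D : ℝ}
    (hslab : ∀ s s' : E3, μ {s} ≠ 0 → μ {s'} ≠ 0 → |inner ℝ (s - s') n| ≤ D) :
    ∃ i : ℕ, μ ∈ {ν : MeasureTheory.Measure (EuclideanSpace ℝ (Fin 3)) | ∀ n m : ℕ, ∀ r : ℚ, (0 : ℝ) < r → ‖TopologicalSpace.denseSeq (EuclideanSpace ℝ (Fin 3)) n - TopologicalSpace.denseSeq (EuclideanSpace ℝ (Fin 3)) m + TopologicalSpace.denseSeq (EuclideanSpace ℝ (Fin 3)) i‖ < 2 - 2 * (r : ℝ) → ν (Metric.ball (TopologicalSpace.denseSeq (EuclideanSpace ℝ (Fin 3)) n) r) = 0 ∨ ν (Metric.ball (TopologicalSpace.denseSeq (EuclideanSpace ℝ (Fin 3)) m) r) = 0} := by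
  have hD : 0 ≤ D := by
    have h0 : μ {0} ≠ 0 := by rw [hμ.measure_zero_singleton]; exact one_ne_zero
    have := hslab 0 0 h0 h0
    simpa using this
  obtain ⟨i, hi⟩ := Metric.denseRange_iff.1 (denseRange_denseSeq E3) ((D + 3) • n) (1 / 2) (by norm_num)
  refine ⟨i, (mem_noPairEvent_iff hμ (denseSeq E3 i)).2 fun s s' hs hs' => ?_⟩
  have h1 : |inner ℝ (s - s') n| ≤ D := hslab s s' hs hs'
  -- `⟪v_i, n⟫ ≥ D + 3 − 1/2`
  have h2 : D + 3 - 1 / 2 ≤ inner ℝ (denseSeq E3 i) n := by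
    have e : inner ℝ (denseSeq E3 i) n = inner ℝ ((D + 3) • n) n + inner ℝ (denseSeq E3 i - (D + 3) • n) n := by
      rw [← inner_add_left, add_sub_cancel]
    have h3 : inner ℝ ((D + 3) • n) n = D + 3 := by
      rw [real_inner_smul_left, real_inner_self_eq_norm_sq, hn]; ring
    have h4 : |inner ℝ (denseSeq E3 i - (D + 3) • n) n| ≤ 1 / 2 := by
      calc |inner ℝ (denseSeq E3 i - (D + 3) • n) n| ≤ ‖denseSeq E3 i - (D + 3) • n‖ * ‖n‖ := abs_real_inner_le_norm _ _
        _ ≤ 1 / 2 := by rw [hn, mul_one, ← dist_eq_norm, dist_comm]; exact hi.le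
    rw [e, h3]
    linarith [neg_abs_le (inner ℝ (denseSeq E3 i - (D + 3) • n) n)]
  -- `‖s − s' + v_i‖ ≥ ⟪s − s' + v_i, n⟫ ≥ 2`
  have h5 : inner ℝ (s - s' + denseSeq E3 i) n ≤ ‖s - s' + denseSeq E3 i‖ := by
    calc inner ℝ (s - s' + denseSeq E3 i) n ≤ |inner ℝ (s - s' + denseSeq E3 i) n| := le_abs_self _
      _ ≤ ‖s - s' + denseSeq E3 i‖ * ‖n‖ := abs_real_inner_le_norm _ _
      _ = ‖s - s' + denseSeq E3 i‖ := by rw [hn, mul_one]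
  rw [inner_add_left] at h5
  linarith [neg_abs_le (inner ℝ (s - s') n)]

/-- **Slab laws are outside the residual**: granted the floor, the crux (by name) is equivalent to its restriction to laws almost surely carried
by configurations contained in NO slab (no unit `n` and `D` with `|⟪s − s', n⟫| ≤ D` for all atoms). [folklore] -/
theorem aperiodicFrustratedLawGap_iff_offSlabs
    (hU : ∀ δ' : ℝ, 0 < δ' → ∀ Q : MeasureTheory.Measure (MeasureTheory.Measure (EuclideanSpace ℝ (Fin 3))), MeasureTheory.IsProbabilityMeasure Q →
      (∀ᵐ μ ∂Q, Literature.Probability.Process.IsRootedHardCore δ' μ) → Literature.Probability.Process.IsPointStationaryLaw Q →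
      (⨅ Q : Literature.MathematicalPhysics.StatisticalMechanics.PeriodicConfiguration 3, Q.energyPerParticle Literature.MathematicalPhysics.StatisticalMechanics.lennardJones) ≤
        ∫ μ, Literature.MathematicalPhysics.StatisticalMechanics.rootEnergy Literature.MathematicalPhysics.StatisticalMechanics.lennardJones μ ∂Q) :
    Summit.AtomisticToContinuum.Crystallization.Theses.FrustratedLawDichotomy.AperiodicFrustratedLawGap ↔
    (∀ δ : ℝ, 0 < δ → ∀ P : MeasureTheory.Measure (MeasureTheory.Measure (EuclideanSpace ℝ (Fin 3))), let Gy : ℝ → (N : ℕ) → (Fin N → EuclideanSpace ℝ (Fin 3)) → Fin N → Prop := fun η N y j => let d : ℝ := sInf ((fun z => dist z (y (j : Fin N))) '' (Set.range (y) \ {(y (j : Fin N))})); let T : Set (EuclideanSpace ℝ (Fin 3)) := {z : EuclideanSpace ℝ (Fin 3) | z ∈ Set.range (y) ∧ z ≠ (y (j : Fin N)) ∧ dist z (y (j : Fin N)) < 13 / 10 * d}; ∃ A : EuclideanSpace ℝ (Fin 3) →ₗᵢ[ℝ] EuclideanSpace ℝ (Fin 3), (∃ e : ↥T ≃ ↥Literature.Geometry.DiscreteGeometry.fccKissingPattern,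 ∀ t : ↥T, dist (d⁻¹ • ((t : EuclideanSpace ℝ (Fin 3)) - (y (j : Fin N)))) (A ((e t : ↥Literature.Geometry.DiscreteGeometry.fccKissingPattern) : EuclideanSpace ℝ (Fin 3))) ≤ η) ∨ (∃ e : ↥T ≃ ↥Literature.Geometry.DiscreteGeometry.hcpKissingPattern, ∀ t : ↥T, dist (d⁻¹ • ((t : EuclideanSpace ℝ (Fin 3)) - (y (j : Fin N)))) (A ((e t : ↥Literature.Geometry.DiscreteGeometry.hcpKissingPattern) : EuclideanSpace ℝ (Fin 3))) ≤ η); let TexBall : (N : ℕ) → (Fin N → EuclideanSpace ℝ (Fin 3)) → Fin N → ℝ → ℝ → ℝ → ℝ → Prop := fun N y i R R₇ R₈ R₉ => (∀ a b : Fin N, a ≠ b → (7 : ℝ) / 10 ≤ dist (y a) (y b)) ∧ (∀ j : Fin N, dist (y j) (y i) ≤ R → ¬ Gy (1 / 20) N (y) j) ∧ (∀ j : Fin N, dist (y j) (y i) ≤ R → ¬ ((∀ j' : Fin N, dist (y j') (y j) ≤ R₇ → ¬ Gy (1 / 20) N (y) j') ∧ (∀ z : EuclideanSpace ℝ (Fin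 3), dist z (y j) ≤ R₇ → ∃ k : Fin N, dist z (y k) ≤ 1) ∧ (∀ j' : Fin N, dist (y j') (y j) ≤ R₇ → (let d : ℝ := sInf ((fun z => dist z (y j')) '' (Set.range (y) \ {(y j')})); ∀ k : Fin N, y k ≠ y j' → dist (y k) (y j') < 27 / 20 * d → 5 ≤ Nat.card {m : Fin N // y m ≠ y j' ∧ dist (y m) (y j') < 27 / 20 * d ∧ y m ≠ y k ∧ dist (y m) (y k) < 27 / 20 * d})))) ∧ (∀ j : Fin N, dist (y j) (y i) ≤ R → ∃ k : Fin N, dist (y k) (y j) ≤ R₈ ∧ Gy (1 / 8) N (y) k) ∧ (∀ j : Fin N, dist (y j) (y i) ≤ R → ¬ ((∀ j' : Fin N, dist (y j') (y j) ≤ R₉ → ¬ Gy (1 / 20) N (y) j') ∧ (Nat.card {j' : Fin N // dist (y j') (y j) ≤ R₉ ∧ ¬ Gy (1 / 8) N (y) j'} : ℝ) ≤ 1 / 2 * (Nat.card {j' : Fin N // dist (y j') (y j) ≤ R₉} : ℝ) ∧ (∀ j' : Fin N, dist (y j') (y j) ≤ R₉ → ¬ Gy (1 / 8) N (y) j' →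 ¬ (let d : ℝ := sInf ((fun z => dist z (y j')) '' (Set.range (y) \ {(y j')})); ∀ k : Fin N, y k ≠ y j' → dist (y k) (y j') < 27 / 20 * d → 5 ≤ Nat.card {m : Fin N // y m ≠ y j' ∧ dist (y m) (y j') < 27 / 20 * d ∧ y m ≠ y k ∧ dist (y m) (y k) < 27 / 20 * d})))); let Appr : MeasureTheory.Measure (EuclideanSpace ℝ (Fin 3)) → ℝ → ℝ → ℝ → Prop := fun μ R₇ R₈ R₉ => ∀ q : EuclideanSpace ℝ (Fin 3), μ {q} ≠ 0 → ∀ R ε : ℝ, 0 < ε → ∃ (N : ℕ) (y : Fin N → EuclideanSpace ℝ (Fin 3)) (i : Fin N), TexBall N y i R R₇ R₈ R₉ ∧ (∀ p : EuclideanSpace ℝ (Fin 3), μ {p} ≠ 0 → dist p q ≤ R → ∃ k : Fin N, dist (y k - y i) (p - q) ≤ ε) ∧ (∀ k : Fin N, dist (y k) (y i) ≤ R → ∃ p : EuclideanSpace ℝ (Fin 3), μ {p} ≠ 0 ∧ dist (y k - y i) (p - q) ≤ ε); MeasureTheory.IsProbabilityMeasure P → (∀ᵐ μ ∂P, Literature.Probability.Process.IsRootedHardCore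 δ μ) → Literature.Probability.Process.IsPointStationaryLaw P → (∃ R₇ R₈ R₉ : ℝ, ∀ᵐ μ ∂P, Appr μ R₇ R₈ R₉) → (∀ᵐ μ ∂P, ∀ p : EuclideanSpace ℝ (Fin 3), μ {p} ≠ 0 → ∀ y : EuclideanSpace ℝ (Fin 3), (∀ q : EuclideanSpace ℝ (Fin 3), μ {q} ≠ 0 → q ≠ p → y ≠ q) → ∑' q : {q : EuclideanSpace ℝ (Fin 3) // μ {q} ≠ 0 ∧ q ≠ p}, Literature.MathematicalPhysics.StatisticalMechanics.lennardJones (dist p (q : EuclideanSpace ℝ (Fin 3))) ≤ ∑' q : {q : EuclideanSpace ℝ (Fin 3) // μ {q} ≠ 0 ∧ q ≠ p}, Literature.MathematicalPhysics.StatisticalMechanics.lennardJones (dist y (q : EuclideanSpace ℝ (Fin 3)))) → P {μ : MeasureTheory.Measure (EuclideanSpace ℝ (Fin 3)) | ∃ Q : Literature.MathematicalPhysics.StatisticalMechanics.PeriodicConfiguration 3, ∃ t : EuclideanSpace ℝ (Fin 3), {p : EuclideanSpace ℝ (Fin 3) | μ {p} ≠ 0} = (fun s => s + t) '' Q.points}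 = 0 → (∀ᵐ μ ∂P, ¬ ∃ n : EuclideanSpace ℝ (Fin 3), ∃ D : ℝ, ‖n‖ = 1 ∧ ∀ s s' : EuclideanSpace ℝ (Fin 3), μ {s} ≠ 0 → μ {s'} ≠ 0 → |inner ℝ (s - s') n| ≤ D) → (⨅ Q : Literature.MathematicalPhysics.StatisticalMechanics.PeriodicConfiguration 3, Q.energyPerParticle Literature.MathematicalPhysics.StatisticalMechanics.lennardJones) < (∫ μ, Literature.MathematicalPhysics.StatisticalMechanics.rootEnergy Literature.MathematicalPhysics.StatisticalMechanics.lennardJones μ ∂P)) := by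
  constructor
  · intro h δ hδ P
    have h' := h δ hδ P
    dsimp only at h' ⊢
    intro hP ha hb hd he h0 _
    exact h' hP ha hb hd he h0
  · intro h
    rw [aperiodicFrustratedLawGap_iff_offAllNoPair hU]
    intro δ hδ P
    have h' := h δ hδ P
    dsimp only at h' ⊢
    intro hP ha hb hd he h0 hoff
    refine h' hP ha hb hd he h0 ?_
    filter_upwards [ha, hoff] with μ hμ hμoff
    rintro ⟨n, D, hn, hslab⟩
    obtain ⟨i, hi⟩ := exists_mem_noPairEvent_of_slab hμ hn hslab
    rw [Set.mem_compl_iff, Set.mem_iUnion, not_exists] at hμoff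
    exact hμoff i hi


end DenseDifferences

end Summit.AtomisticToContinuum.Crystallization.Theorems.FrustratedLawDichotomyAperiodicGapFiniteCut

end
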